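import Summits.CriticalPhenomena.SAWScalingLimit.Theorems.SAWDefectDecoherenceBoundaryClosureRPolygonLocalFlat
import Summits.CriticalPhenomena.SAWScalingLimit.Theorems.SAWDefectDecoherenceBoundaryClosureRPhaseGeometry
import HarnessLib

/-!
# Corner frames: test points with prescribed levels, forms versus levels of scaled faces
(crux `BoundaryClosureR`, stmt-CriticalPhenomena-14004, line `polygon-parity-squeeze`, sub-goal of the
registered stub `polygonLocalIdentity`, step (b)/K4; registered helper `corner_testPoint`)

Two elementary tools for the pinning of the lattice thresholds at an exact corner:

* `exists_point_with_levels` / `corner_testPoint`: for two zigzag normals with `n_{k'} ≠ ±n_k` (they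
  make an angle of `60°` or `120°`: `Re(n_k conj n_{k'}) = ±1/2`, `Im² = 3/4`) and any two levels
  `α, β`, a point `q` with `Re((q - z) conj n_k) = α`, `Re((q - z) conj n_{k'}) = β`,
  `dist q z ≤ 3(|α| + |β|)`;
* `threshold_le_form_of_level`, `not_threshold_le_form_of_level`: the exact threshold test
  `nk ≤ zigzagForm k v` is decided by the level of the scaled centre `δ c_v` against the threshold level
  `δ(√3/2) nk`, up to an error `δ` (level dictionary `level_ge` / `level_le`).

References: folklore (geometry of the honeycomb lattice).  No definition is introduced.
-/

noncomputable section

open scoped Topology ComplexConjugate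
open Filter Set Metric
open Literature.Probability.LatticeModels Literature.Probability.RandomPlanarGeometry
open Literature.Probability.RandomPlanarGeometry.SAW
open Summit.CriticalPhenomena.SAWScalingLimit.Theorems.PickHalfPlane
open Summit.CriticalPhenomena.SAWScalingLimit.Theorems.PolygonParitySqueeze.PhaseGeometry (re_mul_conj_innerNormal
  innerNormal_opp)

namespace Summit.CriticalPhenomena.SAWScalingLimit.Theorems.PolygonParitySqueeze.PolygonLocal

/-! ### 1. The angle between two corner normals -/

/-- **Two non-parallel zigzag normals make an angle of `60°` or `120°`**: `Re(n_k conj n_{k'}) = ±1/2`.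
[folklore] -/
theorem re_mul_conj_eq_half_or {k k' : Fin 6} (hne : innerNormal k' ≠ innerNormal k)
    (hne' : innerNormal k' ≠ -innerNormal k) :
    (innerNormal k * conj (innerNormal k')).re = 1 / 2 ∨ (innerNormal k * conj (innerNormal k')).re = -(1 / 2) := by
  have key : ∀ j l : Fin 6, j ≠ l → j ≠ (![1, 0, 3, 2, 5, 4] : Fin 6 → Fin 6) l →
      3 * (![0, 0, 1, -1, 1, -1] : Fin 6 → ℤ) l * (![0, 0, 1, -1, 1, -1] : Fin 6 → ℤ) j +
        (![2, -2, -1, 1, 1, -1] : Fin 6 → ℤ) l * (![2, -2, -1, 1, 1, -1] : Fin 6 → ℤ) j = 2 ∨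
      3 * (![0, 0, 1, -1, 1, -1] : Fin 6 → ℤ) l * (![0, 0, 1, -1, 1, -1] : Fin 6 → ℤ) j +
        (![2, -2, -1, 1, 1, -1] : Fin 6 → ℤ) l * (![2, -2, -1, 1, 1, -1] : Fin 6 → ℤ) j = -2 := by decide
  have h1 : k' ≠ k := fun h => hne (by rw [h])
  have h2 : k' ≠ (![1, 0, 3, 2, 5, 4] : Fin 6 → Fin 6) k := fun h => hne' (by rw [h, innerNormal_opp])
  rw [re_mul_conj_innerNormal k k']
  rcases key k' k h1 h2 with h | h <;> rw [h] <;> norm_num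

/-- The sine of the angle: `(Im(n_k conj n_{k'}))² = 3/4`. [folklore] -/
theorem im_mul_conj_sq {k k' : Fin 6} (hne : innerNormal k' ≠ innerNormal k)
    (hne' : innerNormal k' ≠ -innerNormal k) :
    (innerNormal k * conj (innerNormal k')).im ^ 2 = 3 / 4 := by
  have hn : Complex.normSq (innerNormal k * conj (innerNormal k')) = 1 := by
    rw [Complex.normSq_eq_norm_sq, norm_mul, Complex.norm_conj, norm_innerNormal, norm_innerNormal]; norm_num
  rw [Complex.normSq_apply] at hn
  rcases re_mul_conj_eq_half_or hne hne' with h | h <;> rw [h] at hn <;> nlinarith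

/-- **Test points with prescribed levels.**  For non-parallel normals `n_k, n_{k'}` and any levels
`α, β` there is a point `q` with `Re((q-z) conj n_k) = α`, `Re((q-z) conj n_{k'}) = β` and
`dist q z ≤ 3(|α| + |β|)`. [folklore] -/
theorem exists_point_with_levels {k k' : Fin 6} (hne : innerNormal k' ≠ innerNormal k)
    (hne' : innerNormal k' ≠ -innerNormal k) (z : ℂ) (α β : ℝ) :
    ∃ q : ℂ, ((q - z) * conj (innerNormal k)).re = α ∧ ((q - z) * conj (innerNormal k')).re = β ∧
      dist q z ≤ 3 * (|α| + |β|) := by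
  set c : ℝ := (innerNormal k * conj (innerNormal k')).re with hc
  set sn : ℝ := (innerNormal k * conj (innerNormal k')).im with hsn
  have hsn2 : sn ^ 2 = 3 / 4 := im_mul_conj_sq hne hne'
  have hsn0 : sn ≠ 0 := fun h => by rw [h] at hsn2; norm_num at hsn2
  have hsnabs : 1 / 2 ≤ |sn| := by nlinarith [abs_nonneg sn, sq_abs sn]
  have hcabs : |c| ≤ 1 / 2 := by
    rcases re_mul_conj_eq_half_or hne hne' with h | h
    · rw [hc, h, abs_of_pos (by norm_num : (0 : ℝ) < 1 / 2)]
    · rw [hc, h, abs_neg, abs_of_pos (by norm_num : (0 : ℝ) < 1 / 2)]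
  set β' : ℝ := (α * c - β) / sn with hβ'
  refine ⟨z + (α : ℂ) * innerNormal k + (β' : ℂ) * (Complex.I * innerNormal k), ?_, ?_, ?_⟩
  · have : (z + (α : ℂ) * innerNormal k + (β' : ℂ) * (Complex.I * innerNormal k) - z) * conj (innerNormal k) =
        (α : ℂ) * (innerNormal k * conj (innerNormal k)) + (β' : ℂ) * Complex.I * (innerNormal k * conj (innerNormal k)) := by
      ring
    rw [this, Complex.add_re, Complex.re_ofReal_mul, re_innerNormal_mul_conj, mul_one]
    rw [Complex.mul_conj, Complex.normSq_eq_norm_sq, norm_innerNormal]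
    simp
  · have : (z + (α : ℂ) * innerNormal k + (β' : ℂ) * (Complex.I * innerNormal k) - z) * conj (innerNormal k') =
        (α : ℂ) * (innerNormal k * conj (innerNormal k')) + (β' : ℂ) * (Complex.I * (innerNormal k * conj (innerNormal k'))) := by
      ring
    rw [this, Complex.add_re, Complex.re_ofReal_mul, Complex.re_ofReal_mul, Complex.I_mul_re, ← hc, ← hsn, hβ']
    field_simp
    ring
  · rw [dist_eq_norm, show z + (α : ℂ) * innerNormal k + (β' : ℂ) * (Complex.I * innerNormal k) - z =
      (α : ℂ) * innerNormal k + (β' : ℂ) * (Complex.I * innerNormal k) by ring]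
    refine (norm_add_le _ _).trans ?_
    rw [norm_mul, norm_mul, norm_mul, Complex.norm_I, one_mul, norm_innerNormal, mul_one, mul_one, Complex.norm_real,
      Complex.norm_real, Real.norm_eq_abs, Real.norm_eq_abs]
    have hβ'le : |β'| ≤ |α| + 2 * |β| := by
      rw [hβ', abs_div, div_le_iff₀ (lt_of_lt_of_le (by norm_num) hsnabs)]
      calc |α * c - β| ≤ |α * c| + |β| := abs_sub _ _
        _ = |α| * |c| + |β| := by rw [abs_mul]
        _ ≤ |α| * (1 / 2) + |β| := by gcongr
        _ ≤ (|α| + 2 * |β|) * (1 / 2) := by linarith [abs_nonneg β]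
        _ ≤ (|α| + 2 * |β|) * |sn| := by gcongr
    linarith [abs_nonneg α, abs_nonneg β]

/-! ### 2. Forms versus levels of scaled faces -/

/-- **Form versus level of a scaled face**: `|δ(√3/2)·zigzagForm k v - Re(δ c_v · conj n_k)| < δ`
(level dictionary). [folklore] -/
theorem abs_form_level_sub_lt {δ : ℝ} (hδ : 0 < δ) (k : Fin 6) (v : HexVertex) :
    |δ * (Real.sqrt 3 / 2) * zigzagForm k v - δ * (hexCenter v * conj (innerNormal k)).re| < δ := by
  have h1 := level_ge k v
  have h2 := level_le k v
  have h3 : Real.sqrt 3 < 2 := by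
    rw [show (2 : ℝ) = Real.sqrt 4 by rw [show (4 : ℝ) = 2 ^ 2 by norm_num, Real.sqrt_sq (by norm_num)]]
    exact Real.sqrt_lt_sqrt (by norm_num) (by norm_num)
  have h0 : 0 < Real.sqrt 3 := Real.sqrt_pos.2 (by norm_num)
  rw [show δ * (Real.sqrt 3 / 2) * zigzagForm k v - δ * (hexCenter v * conj (innerNormal k)).re =
    δ * (Real.sqrt 3 / 2 * (zigzagForm k v : ℝ) - (hexCenter v * conj (innerNormal k)).re) by ring, abs_mul, abs_of_pos hδ]
  have : |Real.sqrt 3 / 2 * (zigzagForm k v : ℝ) - (hexCenter v * conj (innerNormal k)).re| < 1 := by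
    rw [abs_lt]
    rcases neg_one_pow_fin_six k with hs | hs <;> rw [hs] at h1 h2 <;> constructor <;> nlinarith
  nlinarith

/-- **Threshold test, inside**: if the relative level of `δ c_v` exceeds the relative threshold level
`A = δ(√3/2)nk - Re(z conj n_k)` by more than `δ`, then `nk ≤ zigzagForm k v`. [folklore] -/
theorem threshold_le_form_of_level {δ : ℝ} (hδ : 0 < δ) (k : Fin 6) (v : HexVertex) (nk : ℤ) (z : ℂ)
    (h : δ * (Real.sqrt 3 / 2) * nk - (z * conj (innerNormal k)).re + δ <
      (((δ : ℂ) * hexCenter v - z) * conj (innerNormal k)).re) : nk ≤ zigzagForm k v := by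
  have h1 := abs_form_level_sub_lt hδ k v
  rw [signedLevel_smul_sub] at h
  have h2 := (abs_lt.1 h1).1
  have h3 : δ * (Real.sqrt 3 / 2) * nk < δ * (Real.sqrt 3 / 2) * zigzagForm k v := by linarith
  have h4 : (nk : ℝ) < zigzagForm k v := lt_of_mul_lt_mul_left h3 (by positivity)
  exact_mod_cast h4.le

/-- **Threshold test, outside**: if the relative level of `δ c_v` is below the relative threshold level
by more than `δ`, then `¬ nk ≤ zigzagForm k v`. [folklore] -/
theorem not_threshold_le_form_of_level {δ : ℝ} (hδ : 0 < δ) (k : Fin 6) (v : HexVertex) (nk : ℤ) (z : ℂ)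
    (h : (((δ : ℂ) * hexCenter v - z) * conj (innerNormal k)).re <
      δ * (Real.sqrt 3 / 2) * nk - (z * conj (innerNormal k)).re - δ) : ¬ nk ≤ zigzagForm k v := by
  intro hle
  have h1 := abs_form_level_sub_lt hδ k v
  rw [signedLevel_smul_sub] at h
  have h2 := (abs_lt.1 h1).2
  have h3 : δ * (Real.sqrt 3 / 2) * zigzagForm k v < δ * (Real.sqrt 3 / 2) * nk := by linarith
  have h4 : (zigzagForm k v : ℝ) < nk := lt_of_mul_lt_mul_left h3 (by positivity)
  have : (nk : ℝ) ≤ zigzagForm k v := by exact_mod_cast hle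
  linarith

/-- **Registered helper `corner_testPoint`** (∀-form of `exists_point_with_levels`). [folklore] -/
theorem corner_testPoint : ∀ (k k' : Fin 6) (z : ℂ) (α β : ℝ), innerNormal k' ≠ innerNormal k → innerNormal k' ≠ -innerNormal k → ∃ q : ℂ, ((q - z) * (starRingEnd ℂ) (innerNormal k)).re = α ∧ ((q - z) * (starRingEnd ℂ) (innerNormal k')).re = β ∧ dist q z ≤ 3 * (|α| + |β|) :=
  fun _ _ z α β hne hne' => exists_point_with_levels hne hne' z α β

end Summit.CriticalPhenomena.SAWScalingLimit.Theorems.PolygonParitySqueeze.PolygonLocal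

end
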